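import Summits.CriticalPhenomena.PercolationContinuityZ3.Theorems.FK.Transplant.KNFreeSeedsLevels
import Summits.CriticalPhenomena.PercolationContinuityZ3.Theorems.FK.Transplant.KNFreeSeedsLift
import Summits.CriticalPhenomena.PercolationContinuityZ3.Theorems.FK.BernoulliComparison
import HarnessLib

/-!
# FRONTIER TRANSPLANT, row FT-03(a), part 4: Kozma–Nitzan's Lemma 10 Steps II–III (seed manufacture, eqs. (17)–(20)) for the
# random-cluster law of ANY finite subgraph of `ℤ^d` with ANY wired set — all finite-energy hypotheses discharged

Support file (`--supports stmt-CriticalPhenomena-4575`, helper) of the FRONTIER TRANSPLANT sub-cell (`fk-continuity/transplant/`,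
registry row FT-03, seat `prim-bschramm-fkt-p1`); builds on p205010 (kernel theorem, internal audit signed; external expert review
pending).  No definitions, no named facts, no sorries; standard axioms.

HONEST FRAMING (page 1, cell rule).  The transplant's theorem of record `ufsc0_of_freeBoundaryHypothesis_r0 : FH 3 q p → … → ∃ r, UFSC0 3 q p r ε₀`
is CONDITIONAL on the free-boundary penetration hypothesis FH — open at the same `p` for every `q > 1`; by the referee's calibration K1,
[C3a for all `p > p_c(q)`] ∧ C3b gives `p̂_c(q) = p_c(q)`, Grimmett's Conjecture (5.103) / Duminil-Copin–Tassion's Question 5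
(arXiv:1707.07626, p. 9), open for `q ∈ (1,2)`; see the barrier note `SamePFreeBoundaryCriteria` (cell row FBN-01,
`Literature/Barriers/CriticalPhenomena/`, cited statements only) and `FO-19-RECOMMENDATION.md` (NO-GO on criterion 1).  The transplant is a
typed reduction, not a proof of FK continuity.  THIS FILE is an unconditional finite-volume random-cluster theorem (no FH anywhere).

**`KNFree.exists_level_real_Gev_gt_rcMeasure`.**  Let `Λ ⊆ ℤ^d` be finite, `G` any graph on `↥Λ` (the FRESH edges), `B ⊆ ↥Λ` any wired set,
`0 ≤ p < 1`, `q ≥ 1`, and `μ = (φ^B_{G,p,q}).map (liftEdges Λ)` the random-cluster law read on `ℤ^d`.  Let the Kozma–Nitzan level data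
`L = (B₀ = [lo, hi], o, Sfin)` and a weighting `W` satisfy the tree's `KozmaNitzan.LHyp L W p D R` (lattice subbox `D ⊇ B₀⟨R+1⟩`, source
`o ∉ D`) with `W = p` exactly on (a subset of) the lifted edges of `G` and `W ≠ 0` on all of them (so inside `D` every lattice edge is a
fresh edge of `G`).  If `μ(o ↔ B₀) > 1 - δ`, the level range `[j₀, j₁]`, `j₁ ≤ R`, is long enough
(`(1-p)^{-2d·Ncont} ≤ δ · #[j₀,j₁]`), the levels are wide enough for the seed windows, and `(1 - π^{seedBound d M})^k ≤ δ` with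
`π = p/(p + q(1-p))`, then at some level `j ∈ [j₀, j₁]`, with `μ`-probability `> 1 - 3δ`, the cluster of `o` outside `B₀⟨j⟩` has
`≥ Ncont d M k` contact vertices and some selected contact vertex carries an OPEN SEED (KN's event `𝒢`, eq. (19)).
Proof: parts 1–3 — `KNFree.exists_level_real_Gev_gt` (measure-generic Steps II + III) with its three hypotheses discharged by
`KNFree.del_tolerance_rcMeasure_map_liftEdges`, `….ins_tolerance_rcMeasure_map_liftEdges`, `….real_map_liftEdges_compl_posOnly_eq_zero`
(Grimmett's two-sided finite energy, Thm. (3.1) eq. (3.4), transported along the lift); `π ∈ [0,1]` is the cell's `FK.ratio_mem_Icc`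
(`T/FK/BernoulliComparison.lean`).  This covers the free and wired box laws and every
law "fresh subgraph + wired revealed clusters"; the conditioned laws written with edge WEIGHTS (`rcMeasureW (condWeights …) q B`) follow the
same way once the weights form of the tolerance lemmas is in the tree (registry row FO-10b).
[cite: KozmaNitzan2024, §4 Lemma 10, Steps II–III, eqs. (17)–(20) (pp. 18–19)] [cite: Grimmett2006, Thm. (3.1) eq. (3.4) (p. 38); Thm. (4.17)(b) (p. 75); §4.2 (4.11)–(4.12)]
-/

noncomputable section

namespace Summit.CriticalPhenomena.PercolationContinuityZ3.Theorems.FK.KNFree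

open MeasureTheory Set
open Literature.Probability.Percolation Literature.Probability.LatticeModels
open Literature.Probability.Percolation.KozmaNitzan
open scoped Classical

variable {d : ℕ}

/-- **KOZMA–NITZAN LEMMA 10, STEPS II–III, FOR THE RANDOM-CLUSTER LAW OF A FINITE PIECE OF `ℤ^d` WITH AN ARBITRARY WIRED SET** (lifted to
`ℤ^d`): the seed-manufacture bound `μ(𝒢) > 1 - 3δ` at some level, all finite-energy hypotheses of the measure-generic engine discharged.
See the module docstring for the reading of the hypotheses. [cite: KozmaNitzan2024, §4 Lemma 10, Steps II–III, eqs. (17)–(20) (pp. 18–19)]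
[cite: Grimmett2006, Thm. (3.1) eq. (3.4) (p. 38); Thm. (4.17)(b) (p. 75)] -/
theorem exists_level_real_Gev_gt_rcMeasure [NeZero d] (Λ : Finset (Site d)) (G : SimpleGraph ↥Λ) [DecidableRel G.Adj]
    {p : unitInterval} (hp1 : (p : ℝ) < 1) {q : ℝ} (hq : 1 ≤ q) (B : Set ↥Λ)
    {L : LData d} {W : Sym2 (Site d) → unitInterval} {D : Finset (Site d)} {R : ℕ} (hL : LHyp L W p D R)
    (hWG : ∀ e, W e = p → e ∈ G.edgeFinset.image (Sym2.map Subtype.val))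
    (hGW : ∀ e' ∈ G.edgeSet, W (Sym2.map Subtype.val e') ≠ 0)
    {M k j₀ j₁ : ℕ} (hj₁ : j₁ ≤ R) (hwide : ∀ j ∈ Finset.Icc j₀ j₁, ∀ i, L.Lo j i + 2 * M + 2 ≤ L.Hi j i)
    {δ : ℝ} (hJ : 1 / (1 - (p : ℝ)) ^ (2 * d * LData.Ncont d M k) ≤ δ * ((Finset.Icc j₀ j₁).card : ℝ))
    (hk : (1 - ((p : ℝ) / (p + q * (1 - p))) ^ seedBound d M) ^ k ≤ δ)
    (hreach : 1 - δ < ((rcMeasure G (p : ℝ) q B).map (liftEdges Λ)).real L.reachB) :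
    ∃ j ∈ Finset.Icc j₀ j₁, 1 - 3 * δ < ((rcMeasure G (p : ℝ) q B).map (liftEdges Λ)).real (L.Gev j M k) := by
  have hpI : (p : ℝ) ∈ Set.Icc (0 : ℝ) 1 := ⟨p.2.1, p.2.2⟩
  have hq0 : 0 < q := one_pos.trans_le hq
  haveI := isProbabilityMeasure_rcMeasure G hpI hq0 B
  haveI : IsProbabilityMeasure ((rcMeasure G (p : ℝ) q B).map (liftEdges Λ)) :=
    Measure.isProbabilityMeasure_map (measurable_of_finite (liftEdges Λ)).aemeasurable
  obtain ⟨hπ0, hπ1⟩ := ratio_mem_Icc hpI hq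
  refine exists_level_real_Gev_gt ((rcMeasure G (p : ℝ) q B).map (liftEdges Λ)) hL hπ0 hπ1
    (real_map_liftEdges_compl_posOnly_eq_zero Λ G hpI hq0 B W hGW) ?_ ?_ hp1 hj₁ hwide hJ hk hreach
  · intro F A hF hA
    refine del_tolerance_rcMeasure_map_liftEdges Λ G hpI hq B (fun e he => ?_) hA
    obtain ⟨e', -, rfl⟩ := Finset.mem_image.1 (hWG e (hF e he))
    exact Finset.mem_image_of_mem _ (Finset.mem_univ e')
  · intro F A hF hA
    exact ins_tolerance_rcMeasure_map_liftEdges Λ G hpI hq B (fun e he => hWG e (hF e he)) hA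

end Summit.CriticalPhenomena.PercolationContinuityZ3.Theorems.FK.KNFree

end
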